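import Mathlib
import Summits.PneNP.PneNP.Theorems.ConvexRankGatesConvexGateBlindExactLiftingK4
import Summits.PneNP.PneNP.Theorems.ConvexRankGatesConvexGateBlindExactLiftingJuntaSos
import Summits.PneNP.PneNP.Theorems.ConvexRankGatesConvexGateBlindExactLiftingRankCorner

/-!
# PneNP / ConvexRankGates — `ConvexGateBlind`, line `xor-door-perfect-completeness`:
# the K₄ instance is PSD-cheap — a two-square degree-2 SOS certificate, `φ(3) ≤ 2` (lead c5)

Registered sub-goal `exactLifting_phi_three_le_two` of crux item stmt-PneNP-10680 (line
`xor-door-perfect-completeness`, open stub `stub_exactLifting : XorDoor.ExactLifting`).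

The K₄ test instance of record (`K4Inst.K4`, `…ExactLiftingK4.lean`: the odd-charge Tseitin system of
`K₄`, the minimal `d = 3` instance of the stub's hypothesis) was calibrated by earlier leads at
`φ(3) ≤ 5` (degree-5 Sherali–Adams value `1`, landed) and `φ(3) ≤ 4` (Gaussian width, registered by c2,
unlanded).  This file closes the PSD side of K₄ two levels lower with an identity found by hand:

  `4·viol_{K4} − 2 = (χ₀ + χ₁₂ − χ₃₄)² + (χ₅ − χ₁₃ − χ₂₄)²`        (`sosZ_identity`, kernel-decided),

where `χ_S(y) = (−1)^{Σ_{e∈S} y_e}` and edges are numbered as in `K4` (vertex stars `{0,1,2}` (charge 1),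
`{0,3,4}`, `{1,3,5}`, `{2,4,5}`).  Expanding, the cross terms `±2χ₁₂χ₃₄`, `±2χ₁₃χ₂₄` (both `= ±2χ₁₂₃₄`)
cancel between the two squares, each square serves the two stars through its shared singleton edge, and
the constant is `6 = 4·2 − 2`: so for EVERY `ε ≤ 1/2`

  `viol_{K4} − ε = ¼(χ₀ + χ₁₂ − χ₃₄)² + ¼(χ₅ − χ₁₃ − χ₂₄)² + (1/2 − ε)·1²`     (`k4_sos_two`),

a weighted sum of squares of sums of `2`-JUNTAS (`χ_S`, `#S ≤ 2`, and the constant).  (The optimum over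
real coefficients is `ε = 2 − √2`; `1/2` keeps the data rational.)  Consequences:

* `k4_psd_upper`: for every `t ≥ 1` and every `ε ≤ 1/2` the shifted Index-lift `viol_{K4}(x[w]) − ε` has a
  `(PSD_q ⊕ ℝ^0)`-factorisation with `q ≤ 7·t²` (c2's `hasConeFact_shift_of_juntaSos`, seven supports);
* `k4_mixed_window`: together with c3's rank corner (`exactLifting_rank_corner`: `t³ ≤ q·q + r` for every
  cone factorisation of every real shift) the MIXED-cone window of K₄ is `[3/2, 2]`: the stub's own currency
  `q + r` barely sees K₄ (compare the LP window `[3, 5]`, unit level `Θ(t⁵)`);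
* `exactLifting_phi_three_le_two` (registered): every exponent function of `ExactLifting` has
  `φ(3) ≤ 2` (c2's `exactLifting_exponent_le_juntaSos` with `k = 2`).

So at the minimal degree `d = 3` the PSD part of the stub is void on both instances of record (K₄ here,
the triangle instance in `…ExactLiftingTriangle.lean`): genuine PSD content of `stub_exactLifting` starts
where the junta-SOS degree `k(F) := min{k : viol_F − ε ∈ Σ²(k-juntas) for some ε > 0}` grows — it
satisfies `d/2 < k(F) ≤ GaussianWidth(F)` for a degree-`d` fooled `F`, and K₄ shows the upper estimate
can be far from tight (`k = 2 < 4`).  No definitions beyond the file-local linear forms `ell1Z, ell2Z`,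
supports `supp` and coefficients `coef`; the finite identity is kernel-decided over `𝔽₂⁶`.
-/

set_option linter.dupNamespace false -- `Summit.PneNP.PneNP.…`: summit = sub-problem (D-0017)

namespace Summit.PneNP.PneNP.Theorems.XorDoor

open scoped BigOperators
open Finset K4Inst K4PE

noncomputable section

namespace K4Sos2

/-! ## §1 The integer identity `4·viol − 2 = ℓ₁² + ℓ₂²` -/

/-- The first linear form `ℓ₁ = χ₀ + χ₁₂ − χ₃₄` (integer-valued). -/
def ell1Z (y : Fin 6 → ZMod 2) : ℤ := chiZ {0} y + chiZ {1, 2} y - chiZ {3, 4} y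

/-- The second linear form `ℓ₂ = χ₅ − χ₁₃ − χ₂₄` (integer-valued). -/
def ell2Z (y : Fin 6 → ZMod 2) : ℤ := chiZ {5} y - chiZ {1, 3} y - chiZ {2, 4} y

/-- **The two-square identity**, kernel-decided on the 64 points: `4·viol_{K4} − 2 = ℓ₁² + ℓ₂²`. -/
theorem sosZ_identity (y : Fin 6 → ZMod 2) :
    4 * (violN y : ℤ) - 2 = ell1Z y ^ 2 + ell2Z y ^ 2 := by
  have key : ∀ a0 a1 a2 a3 a4 a5 : ZMod 2,
      4 * (violN ![a0, a1, a2, a3, a4, a5] : ℤ) - 2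
        = ell1Z ![a0, a1, a2, a3, a4, a5] ^ 2 + ell2Z ![a0, a1, a2, a3, a4, a5] ^ 2 := by decide
  have hy : y = ![y 0, y 1, y 2, y 3, y 4, y 5] := by funext k; fin_cases k <;> rfl
  rw [hy]; exact key _ _ _ _ _ _

/-- Real form: `viol_{K4}(y) = 1/2 + ¼ ℓ₁(y)² + ¼ ℓ₂(y)²`. -/
theorem viol_eq_sos (y : Fin 6 → ZMod 2) :
    (viol K4 y : ℝ) = 1 / 2 + (1 / 4) * (ell1Z y : ℝ) ^ 2 + (1 / 4) * (ell2Z y : ℝ) ^ 2 := by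
  have h := sosZ_identity y
  have h' : (4 : ℝ) * (violN y : ℝ) - 2 = (ell1Z y : ℝ) ^ 2 + (ell2Z y : ℝ) ^ 2 := by exact_mod_cast h
  rw [viol_K4_eq]
  linarith

/-! ## §2 The certificate in junta-sum form: seven supports of size `≤ 2`, three squares -/

/-- The seven supports: `{0}, {1,2}, {3,4}` (first square), `{5}, {1,3}, {2,4}` (second), `∅` (constant). -/
def supp : Fin 7 → Finset (Fin 6) := ![{0}, {1, 2}, {3, 4}, {5}, {1, 3}, {2, 4}, ∅]

/-- The coefficient table of the three linear forms on the seven characters. -/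
def coef : Fin 3 → Fin 7 → ℝ :=
  ![![1, 1, -1, 0, 0, 0, 0], ![0, 0, 0, 1, -1, -1, 0], ![0, 0, 0, 0, 0, 0, 1]]

/-- Every support has at most two edges. -/
theorem card_supp_le (a : Fin 7) : (supp a).card ≤ 2 := by
  fin_cases a <;> decide

/-- A character `χ_T` is a junta on `T`. -/
theorem chi_junta (T : Finset (Fin 6)) (y y' : Fin 6 → ZMod 2) (h : ∀ i ∈ T, y i = y' i) :
    chi T y = chi T y' := by
  unfold chi
  rw [Finset.sum_congr rfl h]

/-- The three linear forms read off the coefficient table. -/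
theorem sum_coef_chi (y : Fin 6 → ZMod 2) :
    (∑ a, coef 0 a * chi (supp a) y = (ell1Z y : ℝ)) ∧
    (∑ a, coef 1 a * chi (supp a) y = (ell2Z y : ℝ)) ∧
    (∑ a, coef 2 a * chi (supp a) y = 1) := by
  have h7 : ∀ g : Fin 7 → ℝ, ∑ a, g a = g 0 + g 1 + g 2 + g 3 + g 4 + g 5 + g 6 := fun g =>
    Fin.sum_univ_seven g
  have hempty : chi ∅ y = 1 := by simp [chi]
  refine ⟨?_, ?_, ?_⟩
  · rw [h7]
    simp only [coef, supp, Matrix.cons_val_zero, Matrix.cons_val_one, Matrix.cons_val, ell1Z, chi_eq_cast]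
    push_cast
    ring
  · rw [h7]
    simp only [coef, supp, Matrix.cons_val_zero, Matrix.cons_val_one, Matrix.cons_val, ell2Z, chi_eq_cast]
    push_cast
    ring
  · rw [h7]
    simp only [coef, supp, Matrix.cons_val_zero, Matrix.cons_val_one, Matrix.cons_val, hempty]
    norm_num

/-- **Degree-2 junta-SOS certificate of K₄.** For every real `ε`,
`viol_{K4} − ε = Σ_j μ_j (Σ_a coef_{j,a} χ_{supp a})²` with weights `μ = (¼, ¼, ½ − ε)` (non-negative iff
`ε ≤ 1/2`) and supports of size `≤ 2`. -/
theorem k4_sos_two (ε : ℝ) :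
    ∀ y : Fin 6 → ZMod 2, (viol K4 y : ℝ) - ε =
      ∑ j : Fin 3, (![1 / 4, 1 / 4, 1 / 2 - ε] : Fin 3 → ℝ) j * (∑ a, coef j a * chi (supp a) y) ^ 2 := by
  intro y
  obtain ⟨h0, h1, h2⟩ := sum_coef_chi y
  rw [Fin.sum_univ_three]
  simp only [Matrix.cons_val_zero, Matrix.cons_val_one, Matrix.cons_val]
  rw [h0, h1, h2, viol_eq_sos y]
  ring

/-! ## §3 Consequences: PSD upper bound, the mixed window of K₄, `φ(3) ≤ 2` -/

/-- **K₄ is PSD-cheap.** For every `t ≥ 1` and every `ε ≤ 1/2`, the shifted Index-lift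
`viol_{K4}(x[w]) − ε` has a `(PSD_q ⊕ ℝ^0)`-factorisation with `q ≤ 7·t²`. -/
theorem k4_psd_upper {t : ℕ} (ht : 1 ≤ t) {ε : ℝ} (hε : ε ≤ 1 / 2) :
    ∃ q : ℕ, q ≤ 7 * t ^ 2 ∧
      HasConeFact (fun (x : Fin 6 → Fin t → ZMod 2) (w : Fin 6 → Fin t) =>
        (viol K4 (fun i => x i (w i)) : ℝ) - ε) q 0 := by
  have hμ : ∀ j : Fin 3, 0 ≤ (![1 / 4, 1 / 4, 1 / 2 - ε] : Fin 3 → ℝ) j := by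
    intro j; fin_cases j
    · show (0 : ℝ) ≤ 1 / 4; norm_num
    · show (0 : ℝ) ≤ 1 / 4; norm_num
    · show (0 : ℝ) ≤ 1 / 2 - ε; linarith
  obtain ⟨q, hq, hfact⟩ := hasConeFact_shift_of_juntaSos (k := 2) ht K4 (fun j => (![1 / 4, 1 / 4, 1 / 2 - ε] :
      Fin 3 → ℝ) j) hμ supp card_supp_le (fun j a y => coef j a * chi (supp a) y)
    (fun j a y y' h => by rw [chi_junta (supp a) y y' h]) (k4_sos_two ε)
  exact ⟨q, by simpa using hq, hfact⟩

/-- **The mixed-cone window of K₄ is `[3/2, 2]`.** (lower, c3's rank corner) for every gadget size `t`,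
every real `ε` and every `(PSD_q ⊕ ℝ^r_{≥0})`-factorisation of `viol_{K4}(x[w]) − ε`: `t³ ≤ q·q + r`;
(upper, this file) for `t ≥ 1` and `ε ≤ 1/2` there is one with `r = 0` and `q ≤ 7·t²`. -/
theorem k4_mixed_window :
    (∀ (t : ℕ) (ε : ℝ) (q r : ℕ),
      HasConeFact (fun (x : Fin 6 → Fin t → ZMod 2) (w : Fin 6 → Fin t) =>
        (viol K4 (fun i => x i (w i)) : ℝ) - ε) q r → t ^ 3 ≤ q * q + r) ∧
    (∀ (t : ℕ) (ε : ℝ), 1 ≤ t → ε ≤ 1 / 2 → ∃ q : ℕ, q ≤ 7 * t ^ 2 ∧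
      HasConeFact (fun (x : Fin 6 → Fin t → ZMod 2) (w : Fin 6 → Fin t) =>
        (viol K4 (fun i => x i (w i)) : ℝ) - ε) q 0) :=
  ⟨fun t ε q r h => exactLifting_rank_corner (le_refl 3) k4_unsat hasPerfectPseudoExp t ε q r h,
    fun _ _ ht hε => k4_psd_upper ht hε⟩

end K4Sos2

/-- **Registered sub-goal `exactLifting_phi_three_le_two` of stmt-PneNP-10680.** Calibration of the
stub at its minimal degree, PSD side: every exponent function of `ExactLifting` has `φ(3) ≤ 2` — the K₄
instance is unsatisfiable, degree-3 fooled, and `viol_{K4} − 1/2` is a weighted sum of squares of sums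
of `2`-juntas (`K4Sos2.k4_sos_two`); c2's `exactLifting_exponent_le_juntaSos`. -/
theorem exactLifting_phi_three_le_two : ExactLifting →
    ∃ φ : ℕ → ℕ, (∀ K : ℕ, ∃ d : ℕ, K ≤ φ d) ∧
      (∀ (m d : ℕ) (F : Finset (Pool m)),
        (¬ ∃ y : Fin m → ZMod 2, ∀ e ∈ F, Sat y e) → HasPerfectPseudoExp d F →
        ∃ T : ℕ, ∀ (t : ℕ) (ε : ℝ), T ≤ t → 0 < ε → ∀ q r : ℕ,
          HasConeFact (fun (x : Fin m → Fin t → ZMod 2) (w : Fin m → Fin t) =>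
            (viol F (fun i => x i (w i)) : ℝ) - ε) q r → t ^ φ d ≤ q + r) ∧
      φ 3 ≤ 2 := by
  rintro ⟨φ, hφu, hφ⟩
  refine ⟨φ, hφu, hφ, ?_⟩
  have hμ : ∀ j : Fin 3, 0 ≤ (![1 / 4, 1 / 4, 1 / 2 - 1 / 2] : Fin 3 → ℝ) j := by
    intro j; fin_cases j <;> simp
  exact exactLifting_exponent_le_juntaSos φ hφ (k := 2) K4Inst.K4 K4Inst.k4_unsat K4PE.hasPerfectPseudoExp
    (ε := 1 / 2) (by norm_num) (fun j => (![1 / 4, 1 / 4, 1 / 2 - 1 / 2] : Fin 3 → ℝ) j) hμ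
    K4Sos2.supp K4Sos2.card_supp_le (fun j a y => K4Sos2.coef j a * K4PE.chi (K4Sos2.supp a) y)
    (fun j a y y' h => by rw [K4Sos2.chi_junta (K4Sos2.supp a) y y' h]) (K4Sos2.k4_sos_two (1 / 2))

/-! ## §4 (appended, lead c5) The PSD floor: a perfect pseudo-expectation forbids junta-SOS
certificates of half its degree — the junta-SOS degree of K₄ is EXACTLY 2 -/

/-- **Registered sub-goal `no_juntaSos_shift_of_perfect` of stmt-PneNP-10680** (the PSD-side floor of the
stub's calibration; companion of c1's `no_blockJunta_shift` on the LP side).  If `F` carries a degree-`d`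
perfect-completeness pseudo-expectation, then for every `ε > 0` there is NO identity
`viol_F − ε = Σ_j μ_j (Σ_a f_{j,a})²` with weights `μ_j ≥ 0` and every `f_{j,a}` a junta on a set of size
`≤ d/2` (any number of squares and supports): apply `Ẽ` — the left side evaluates to `−ε < 0`, every
square of a sum of `(d/2)`-juntas to `≥ 0`.  So the junta-SOS degree `k(F)` of a degree-`d` fooled system
exceeds `d/2`, while c2's calibration bounds the stub's exponent by `k(F)` from above. -/
theorem no_juntaSos_shift_of_perfect :
    ∀ {m d : ℕ} {F : Finset (Pool m)}, HasPerfectPseudoExp d F → ∀ {ε : ℝ}, 0 < ε →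
      ∀ {J A : Type} [Fintype J] [Fintype A] (μ : J → ℝ) (S : A → Finset (Fin m))
        (f : J → A → (Fin m → ZMod 2) → ℝ),
        (∀ j, 0 ≤ μ j) → (∀ a, (S a).card ≤ d / 2) →
        (∀ j a (y y' : Fin m → ZMod 2), (∀ i ∈ S a, y i = y' i) → f j a y = f j a y') →
        ¬ ∀ y : Fin m → ZMod 2, (viol F y : ℝ) - ε = ∑ j, μ j * (∑ a, f j a y) ^ 2 := by
  intro m d F hPE ε hε J A _ _ μ S f hμ hS hf hcert
  obtain ⟨E, -, hsq, hE1, hEviol⟩ := hPE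
  -- the two sides as functions of `y`
  have hfun : (fun y => (viol F y : ℝ)) - ε • (fun _ => (1 : ℝ)) =
      ∑ j, μ j • ((fun y => ∑ a, f j a y) * (fun y => ∑ a, f j a y)) := by
    funext y
    simp only [Pi.sub_apply, Pi.smul_apply, smul_eq_mul, mul_one, Finset.sum_apply, Pi.mul_apply]
    rw [hcert y]
    refine Finset.sum_congr rfl fun j _ => ?_
    ring
  -- apply the pseudo-expectation
  have hL : E ((fun y => (viol F y : ℝ)) - ε • (fun _ => (1 : ℝ))) = -ε := by
    rw [map_sub, map_smul, hEviol, hE1, smul_eq_mul, mul_one, zero_sub]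
  have hR : 0 ≤ E (∑ j, μ j • ((fun y => ∑ a, f j a y) * (fun y => ∑ a, f j a y))) := by
    rw [map_sum]
    refine Finset.sum_nonneg fun j _ => ?_
    rw [map_smul, smul_eq_mul]
    refine mul_nonneg (hμ j) (hsq _ ?_)
    -- `y ↦ Σ_a f_{j,a}(y)` lies in the span of the `(d/2)`-juntas
    have : (fun y => ∑ a, f j a y) = ∑ a, (fun y => f j a y) := by
      funext y; simp only [Finset.sum_apply]
    rw [this]
    refine Submodule.sum_mem _ fun a _ => Submodule.subset_span ?_
    exact ⟨S a, hS a, fun y y' h => hf j a y y' h⟩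
  rw [hfun] at hL
  rw [hL] at hR
  linarith

/-- **The junta-SOS degree of K₄ is exactly `2`.**  (floor) For every `ε > 0` there is no identity
`viol_{K4} − ε = Σ_j μ_j (Σ_a f_{j,a})²` with `μ ≥ 0` and `1`-junta summands (`3/2 = 1` rounds down; by
`K4PE.hasPerfectPseudoExp` and `no_juntaSos_shift_of_perfect`); (ceiling) for every `ε ≤ 1/2` there is one
with `2`-junta summands (`K4Sos2.k4_sos_two`). -/
theorem k4_juntaSos_degree_two :
    (∀ (ε : ℝ), 0 < ε → ∀ {J A : Type} [Fintype J] [Fintype A] (μ : J → ℝ) (S : A → Finset (Fin 6))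
        (f : J → A → (Fin 6 → ZMod 2) → ℝ),
        (∀ j, 0 ≤ μ j) → (∀ a, (S a).card ≤ 1) →
        (∀ j a (y y' : Fin 6 → ZMod 2), (∀ i ∈ S a, y i = y' i) → f j a y = f j a y') →
        ¬ ∀ y : Fin 6 → ZMod 2, (viol K4Inst.K4 y : ℝ) - ε = ∑ j, μ j * (∑ a, f j a y) ^ 2) ∧
    (∀ (ε : ℝ), ε ≤ 1 / 2 → ∃ (μ : Fin 3 → ℝ) (S : Fin 7 → Finset (Fin 6))
        (f : Fin 3 → Fin 7 → (Fin 6 → ZMod 2) → ℝ),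
        (∀ j, 0 ≤ μ j) ∧ (∀ a, (S a).card ≤ 2) ∧
        (∀ j a (y y' : Fin 6 → ZMod 2), (∀ i ∈ S a, y i = y' i) → f j a y = f j a y') ∧
        ∀ y : Fin 6 → ZMod 2, (viol K4Inst.K4 y : ℝ) - ε = ∑ j, μ j * (∑ a, f j a y) ^ 2) := by
  refine ⟨fun ε hε J A _ _ μ S f hμ hS hf => ?_, fun ε hε => ?_⟩
  · exact no_juntaSos_shift_of_perfect (d := 3) K4PE.hasPerfectPseudoExp hε μ S f hμ hS hf
  · refine ⟨(![1 / 4, 1 / 4, 1 / 2 - ε] : Fin 3 → ℝ), K4Sos2.supp,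
      fun j a y => K4Sos2.coef j a * K4PE.chi (K4Sos2.supp a) y, fun j => ?_, K4Sos2.card_supp_le,
      fun j a y y' h => by simp only [K4Sos2.chi_junta (K4Sos2.supp a) y y' h], K4Sos2.k4_sos_two ε⟩
    fin_cases j
    · show (0 : ℝ) ≤ 1 / 4; norm_num
    · show (0 : ℝ) ≤ 1 / 4; norm_num
    · show (0 : ℝ) ≤ 1 / 2 - ε; linarith

end

end Summit.PneNP.PneNP.Theorems.XorDoor
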